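import Summits.NavierStokesRegularity.NavierStokesRegularity.Theorems.TypeICertificateLadderStrainRateMaxPrincipleNonneg
import Summits.NavierStokesRegularity.NavierStokesRegularity.Theorems.TypeICertificateLadderStrainRateWeightedVorticity
import Summits.NavierStokesRegularity.NavierStokesRegularity.Theorems.TypeICertificateLadderRungReynoldsOneTaoCover
import Literature.Analysis.FluidPDE.NSVorticityBKMHolds
import Mathlib.MeasureTheory.Integral.IntervalIntegral.FundThmCalculus
import HarnessLib

/-!
# Route TypeICertificateLadder — the time-integrated aligned-stretching criterion, Euler and
  Navier–Stokes (`ν ≥ 0`; companion of C32/C35 of cell pub-ns-dss; helper of crux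
  stmt-NavierStokesRegularity-2882)

The weight method behind C32 (`(T − t)^{2θ}|ω|²`) works with any differentiable majorant of the
stretching rate ALONG the vorticity: if `⟪∇u(t,x) ω, ω⟫ ≤ λ̄(t)|ω|²` on a final window `(t₀, T)` and
`Λ' = λ̄` with `Λ` BOUNDED ABOVE on `(0, T)` — i.e. the aligned stretching rate is time-integrable up
to `T` — then `P = e^{−2Λ(t)}|ω|²` is a subsolution of `∂ₜP ≤ νΔP − u·∇P` (Kato, `strainWeight_algebra`),
the whole-space maximum principle (`le_of_subsolution_linear_drift_of_nonneg`, `ν ≥ 0`) bounds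
`‖ω(t)‖_∞ ≤ e^{Λ(t) − Λ(t₀)}‖ω(t₀)‖_∞`, and the Beale–Kato–Majda criterion (`beale_kato_majda_holds`,
`ν ≥ 0`) continues the solution past `T`. For Euler this is the classical transport of `|ω|` by
`α = ξ·Sξ` along trajectories (Constantin, SIAM Rev. 36 (1994); Chae 2010 Thm 1.1's proof) — here
WITHOUT trajectories and uniformly in `ν ≥ 0`. Unlike C32 (which is sharp in the power scale
`θ/(T − t)`, where `∫λ̄ = ∞`), this criterion handles integrable rates such as `c(T − t)^{−1/2}`.

* `weightedVorticity_le_of_alignedStretching_le_deriv` — `e^{−2Λ(t)}|ω(t,x)|² ≤ e^{−2Λ(t₀)} sup|ω(t₀)|²`;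
* `hasSobolevExtensionPast_of_alignedStretching_le_deriv` — continuation (`Λ` bounded above);
* `hasSobolevExtensionPast_of_alignedStretching_le_continuousOn` — the same for a rate `λ̄`
  continuous on the CLOSED interval `[t₀, T]` (`Λ = ∫_{t₀} λ̄`);
* `typeICertificateLadder_not_dominated_alignedStretching` — Fefferman class, contrapositive.

HONEST FRAMING: statements about a HYPOTHETICAL singular time; nothing here bears on the regularity
question itself. Lands `--supports stmt-NavierStokesRegularity-2882`.
-/

noncomputable section

namespace Summit.NavierStokesRegularity.NavierStokesRegularity.Theorems

set_option linter.dupNamespace false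

open MeasureTheory Set Filter Topology Function
open scoped RealInnerProductSpace Laplacian ContDiff
open Literature.Analysis Literature.Analysis.FluidPDE

/-- **`e^{−2Λ(t)}|ω(t,x)|² ≤ e^{−2Λ(t₀)} sup|ω(t₀)|²` on `[t₀, T)` when `⟪∇u ω, ω⟫ ≤ Λ'(t)|ω|²` on
`(t₀, T)`.** Let `(u, p)` be a classical Euler (`ν = 0`) or Navier–Stokes (`ν > 0`) solution on
`ℝ³ × [0,T)` in the BKM class on every `[0,T'']`, `T'' < T`; let `Λ` be differentiable on `(0,T)` with
derivative `λ̄`, and suppose `⟪∇u(t,x) ω(t,x), ω(t,x)⟫ ≤ λ̄(t)|ω(t,x)|²` for all `x` and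
`t ∈ (t₀, T)` (`0 < t₀ < T`). Then `e^{−2Λ(t)}‖ω(t,x)‖²` is bounded on `[t₀, T)` by `e^{−2Λ(t₀)}(‖curlCLM‖ sup‖∇u(t₀)‖)²`
(Kato + `strainWeight_algebra` with `κ = λ̄(t)`, `c = e^{−2Λ(t)}`; BKM-class sup bounds;
`le_of_subsolution_linear_drift_of_nonneg`). [folklore] -/
theorem weightedVorticity_le_of_alignedStretching_le_deriv {ν T t₀ : ℝ} (hν : 0 ≤ ν)
    (ht₀ : 0 < t₀) (ht₀T : t₀ < T)
    {u : ℝ → EuclideanSpace ℝ (Fin 3) → EuclideanSpace ℝ (Fin 3)}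
    {p : ℝ → EuclideanSpace ℝ (Fin 3) → ℝ}
    (hsol : IsClassicalNSSolutionOn (Ico 0 T) ν 0 u p)
    (hreg : ∀ T'' < T, HasBoundedSobolevNormsOn (Icc 0 T'') u)
    {Λ lam : ℝ → ℝ} (hΛ : ∀ t ∈ Ioo 0 T, HasDerivAt Λ (lam t) t)
    (hstretch : ∀ t ∈ Ioo t₀ T, ∀ x,
      ⟪fderiv ℝ (u t) x (curl (u t) x), curl (u t) x⟫ ≤ lam t * ‖curl (u t) x‖ ^ 2) :
    ∃ M : ℝ, ∀ t ∈ Ico t₀ T, ∀ x, Real.exp (-2 * Λ t) * ‖curl (u t) x‖ ^ 2 ≤ M := by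
  -- the solution on the open slab and its vorticity equation (two-sided time derivative)
  have hsolo : IsClassicalNSSolutionOn (Ioo 0 T) ν 0 u p :=
    hsol.mono Ioo_subset_Ico_self isOpen_Ioo.uniqueDiffOn
  have hsm : IsSmoothSpaceTimeOn (Ioo 0 T) u := hsolo.smooth_velocity
  have hvort : IsSmoothSpaceTimeOn (Ioo 0 T) (vorticity u) := by
    have h1 := (hsm.isSmoothSpaceTimeOn_fderiv_of_isOpen isOpen_Ioo).clm curlCLM
    have e : (fun t x => curlCLM (fderiv ℝ (u t) x)) = vorticity u := by funext s y; rfl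
    rwa [e] at h1
  have hV := hsolo.isVorticitySolutionOn_zero_force isOpen_Ioo.uniqueDiffOn
    (by rw [interior_Ioo]; exact subset_closure)
  have hveq : ∀ t ∈ Ioo 0 T, ∀ x,
      deriv (fun s => curl (u s) x) t + fderiv ℝ (curl (u t)) x (u t x) =
        fderiv ℝ (u t) x (curl (u t) x) + ν • (Δ (curl (u t))) x := by
    intro t ht x
    have h := hV.vorticity_eq t ht x
    simp only [timeDerivWithin_eq_deriv isOpen_Ioo ht, convect_apply, vorticity_apply] at h
    exact h
  have hsmooth : ∀ t ∈ Ico 0 T, ContDiff ℝ ∞ (u t) := fun t ht => hsol.contDiff_velocity ht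
  -- the initial bound
  obtain ⟨B₁, hB₁0, hB₁⟩ := exists_forall_norm_iteratedFDeriv_le_bkmClass
    (fun s hs => hsmooth s ⟨hs.1, hs.2.trans_lt ht₀T⟩) (hreg t₀ ht₀T) 1
  set κ₀ : ℝ := ‖(curlCLM : (EuclideanSpace ℝ (Fin 3) →L[ℝ] EuclideanSpace ℝ (Fin 3)) →L[ℝ]
    EuclideanSpace ℝ (Fin 3))‖ with hκ₀
  have hκ₀0 : 0 ≤ κ₀ := by rw [hκ₀]; positivity
  have hcurl_le : ∀ (f : EuclideanSpace ℝ (Fin 3) → EuclideanSpace ℝ (Fin 3)) (x),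
      ‖curl f x‖ ≤ κ₀ * ‖iteratedFDeriv ℝ 1 f x‖ := fun f x => by
    rw [curl_eq_curlCLM, ← norm_iteratedFDeriv_fderiv, norm_iteratedFDeriv_zero]
    exact ContinuousLinearMap.le_opNorm _ _
  set M : ℝ := Real.exp (-2 * Λ t₀) * (κ₀ * B₁) ^ 2 with hMdef
  refine ⟨M, fun t ht x => ?_⟩
  have hω₀ : ∀ y, ‖curl (u t₀) y‖ ≤ κ₀ * B₁ := fun y =>
    (hcurl_le _ y).trans (mul_le_mul_of_nonneg_left (hB₁ t₀ ⟨ht₀.le, le_rfl⟩ y) hκ₀0)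
  have hPt₀ : ∀ y, Real.exp (-2 * Λ t₀) * ‖curl (u t₀) y‖ ^ 2 ≤ M := fun y => by
    rw [hMdef]
    exact mul_le_mul_of_nonneg_left (pow_le_pow_left₀ (norm_nonneg _) (hω₀ y) 2)
      (Real.exp_pos _).le
  rcases ht.1.eq_or_lt with rfl | ht₀t
  · exact hPt₀ x
  -- the maximum principle on `[t₀, T₂]`, `T₂ = t`
  set T₂ : ℝ := t with hT₂
  have hT₂T : T₂ < T := ht.2
  obtain ⟨K, hK0, hK⟩ := exists_forall_norm_iteratedFDeriv_le_bkmClass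
    (fun s hs => hsmooth s ⟨hs.1, hs.2.trans_lt hT₂T⟩) (hreg T₂ hT₂T) 0
  obtain ⟨B₂, hB₂0, hB₂⟩ := exists_forall_norm_iteratedFDeriv_le_bkmClass
    (fun s hs => hsmooth s ⟨hs.1, hs.2.trans_lt hT₂T⟩) (hreg T₂ hT₂T) 1
  have huK : ∀ s ∈ Icc 0 T₂, ∀ y, ‖u s y‖ ≤ K := fun s hs y => by
    have h := hK s hs y
    rwa [norm_iteratedFDeriv_zero] at h
  have hωB : ∀ s ∈ Icc 0 T₂, ∀ y, ‖curl (u s) y‖ ≤ κ₀ * B₂ := fun s hs y =>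
    (hcurl_le _ y).trans (mul_le_mul_of_nonneg_left (hB₂ s hs y) hκ₀0)
  have hIoc_sub : ∀ {s}, s ∈ Ioc t₀ T₂ → s ∈ Ioo 0 T := fun {s} hs =>
    ⟨ht₀.trans hs.1, hs.2.trans_lt hT₂T⟩
  have hIcc_sub : ∀ {s}, s ∈ Icc t₀ T₂ → s ∈ Ioo 0 T := fun {s} hs =>
    ⟨ht₀.trans_le hs.1, hs.2.trans_lt hT₂T⟩
  -- `Λ` is continuous on `[t₀, T₂]`, hence bounded below there
  have hΛc : ContinuousOn Λ (Icc t₀ T₂) := fun s hs =>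
    (hΛ s (hIcc_sub hs)).continuousAt.continuousWithinAt
  obtain ⟨L₀, hL₀⟩ : ∃ L₀ : ℝ, ∀ s ∈ Icc t₀ T₂, -2 * Λ s ≤ L₀ := by
    obtain ⟨C, hC⟩ := (isCompact_Icc.image_of_continuousOn hΛc).isBounded.exists_norm_le
    refine ⟨2 * C, fun s hs => ?_⟩
    have h := hC (Λ s) ⟨s, hs, rfl⟩
    rw [Real.norm_eq_abs] at h
    linarith [neg_abs_le (Λ s)]
  -- the weighted density
  set P : ℝ → EuclideanSpace ℝ (Fin 3) → ℝ :=
    fun s y => Real.exp (-2 * Λ s) * ‖curl (u s) y‖ ^ 2 with hPdef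
  set Pₜ : ℝ → EuclideanSpace ℝ (Fin 3) → ℝ := fun s y =>
    Real.exp (-2 * Λ s) * (-2 * lam s) * ‖curl (u s) y‖ ^ 2 +
      Real.exp (-2 * Λ s) * (2 * ⟪curl (u s) y, deriv (fun σ => curl (u σ) y) s⟫) with hPₜdef
  have key := le_of_subsolution_linear_drift_of_nonneg (T₁ := t₀) (T₂ := T₂) (M := M)
    (B := Real.exp L₀ * (κ₀ * B₂) ^ 2) (K := K) (P := P) (Pₜ := Pₜ) hν hK0 ?_ ?_ ?_ ?_ ?_ ?_
  · exact key t ⟨ht₀t.le, le_rfl⟩ x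
  · -- joint continuity on `[t₀, T₂] × ℝ³`
    have hw : ContinuousOn (fun z : ℝ × EuclideanSpace ℝ (Fin 3) => Real.exp (-2 * Λ z.1))
        (Icc t₀ T₂ ×ˢ univ) :=
      ((hΛc.comp continuous_fst.continuousOn fun z hz => (mem_prod.1 hz).1).const_smul
        (-2 : ℝ)).rexp.congr fun z _ => by simp [smul_eq_mul]
    have hωc : ContinuousOn (fun z : ℝ × EuclideanSpace ℝ (Fin 3) => ‖vorticity u z.1 z.2‖ ^ 2)
        (Icc t₀ T₂ ×ˢ univ) := by
      refine ((hvort.continuousOn.mono ?_).norm).pow 2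
      exact prod_mono (fun s hs => hIcc_sub hs) subset_rfl
    refine (hw.mul hωc).congr fun z _ => ?_
    simp only [hPdef, uncurry, Pi.mul_apply, vorticity_apply]
  · -- `C²` slices
    intro s hs
    have hω : ContDiff ℝ 2 (curl (u s)) := by
      rw [← vorticity_apply]
      exact (hvort.contDiff_slice (hIoc_sub hs)).of_le (by norm_cast)
    exact contDiff_const.mul (hω.norm_sq ℝ)
  · -- time derivative
    intro s hs y
    have hs' := hIoc_sub hs
    have hw : HasDerivAt (fun σ => Real.exp (-2 * Λ σ)) (Real.exp (-2 * Λ s) * (-2 * lam s)) s := by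
      have h := ((hΛ s hs').const_mul (-2 : ℝ)).exp
      simpa using h
    have hωt : HasDerivAt (fun σ => curl (u σ) y) (deriv (fun σ => curl (u σ) y) s) s := by
      have h := hvort.hasDerivAt_timeLine isOpen_Ioo hs' y
      simpa only [vorticity_apply] using h
    exact hw.mul hωt.norm_sq
  · -- the subsolution inequality
    intro s hs y
    have hs' := hIoc_sub hs
    have hω2 : ContDiff ℝ 2 (curl (u s)) := by
      rw [← vorticity_apply]
      exact (hvort.contDiff_slice hs').of_le (by norm_cast)
    have hωd : DifferentiableAt ℝ (curl (u s)) y := (hω2.differentiable (by norm_num)) y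
    set c : ℝ := Real.exp (-2 * Λ s) with hcdef
    have hc0 : 0 ≤ c := (Real.exp_pos _).le
    have hF2 : ContDiff ℝ 2 (fun z => ‖curl (u s) z‖ ^ 2) := hω2.norm_sq ℝ
    have hPs : P s = c • fun z => ‖curl (u s) z‖ ^ 2 := by
      funext z; simp only [hPdef, Pi.smul_apply, smul_eq_mul, hcdef]
    have hLap : (Δ (P s)) y = c * (2 * ⟪(Δ (curl (u s))) y, curl (u s) y⟫ +
        2 * frobeniusNormSq (fderiv ℝ (curl (u s)) y)) := by
      rw [hPs, InnerProductSpace.laplacian_smul c (hF2.contDiffAt), smul_eq_mul,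
        laplacian_norm_sq_comp hω2 y]
    have hgrad : ∀ w, fderiv ℝ (P s) y w = c * (2 * ⟪curl (u s) y, fderiv ℝ (curl (u s)) y w⟫) := by
      intro w
      rw [hPs, fderiv_const_smul ((hF2.differentiable (by norm_num)) y),
        FunLike.coe_smul, Pi.smul_apply, smul_eq_mul, fderiv_norm_sq_comp_apply hωd w]
    have hc' : c * (-2 * lam s) = -(2 * lam s) * c := by ring
    have halg := strainWeight_algebra (hveq s hs' y)
      (frobeniusNormSq_nonneg (fderiv ℝ (curl (u s)) y)) hν (hstretch s ⟨hs.1, hs'.2⟩ y) hc0 hc'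
    have hdrift : -(fderiv ℝ (P s) y (u s y)) ≤ K * (1 + ‖y‖) * ‖fderiv ℝ (P s) y‖ := by
      have h1 : -(fderiv ℝ (P s) y (u s y)) ≤ ‖fderiv ℝ (P s) y‖ * ‖u s y‖ :=
        (neg_le_abs _).trans ((Real.norm_eq_abs _).symm.le.trans (ContinuousLinearMap.le_opNorm _ _))
      have h2 : ‖fderiv ℝ (P s) y‖ * ‖u s y‖ ≤ ‖fderiv ℝ (P s) y‖ * K :=
        mul_le_mul_of_nonneg_left (huK s ⟨hs'.1.le, hs.2⟩ y) (norm_nonneg _)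
      have h3 : ‖fderiv ℝ (P s) y‖ * K ≤ K * (1 + ‖y‖) * ‖fderiv ℝ (P s) y‖ := by
        have : 0 ≤ K * ‖y‖ * ‖fderiv ℝ (P s) y‖ := by positivity
        nlinarith
      linarith
    show Pₜ s y ≤ ν * (Δ (P s)) y + K * (1 + ‖y‖) * ‖fderiv ℝ (P s) y‖
    rw [hLap]
    have e1 : Pₜ s y = c * (-2 * lam s) * ‖curl (u s) y‖ ^ 2 +
        c * (2 * ⟪curl (u s) y, deriv (fun σ => curl (u σ) y) s⟫) := rfl
    rw [e1]
    have e2 := hgrad (u s y)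
    linarith [halg, hdrift, e2]
  · -- bounded above
    intro s hs y
    have hs' := hIcc_sub hs
    have hw : Real.exp (-2 * Λ s) ≤ Real.exp L₀ := Real.exp_le_exp.2 (hL₀ s hs)
    have hωb : ‖curl (u s) y‖ ^ 2 ≤ (κ₀ * B₂) ^ 2 :=
      pow_le_pow_left₀ (norm_nonneg _) (hωB s ⟨hs'.1.le, hs.2⟩ y) 2
    exact mul_le_mul hw hωb (sq_nonneg _) (Real.exp_pos _).le
  · exact hPt₀

/-- **Time-integrable aligned stretching continues the solution (`ν ≥ 0`).** Let `(u, p)` be a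
classical Euler or Navier–Stokes solution on `ℝ³ × [0,T)`, `T > 0`, in the BKM class on every
`[0,T'']`, `T'' < T`; let `Λ` be differentiable on `(0,T)` with `Λ' = λ̄` and BOUNDED ABOVE on `(0,T)`,
and suppose `⟪∇u(t,x) ω, ω⟫ ≤ λ̄(t)|ω|²` on `(t₀, T) × ℝ³` for some `t₀ < T`. Then the solution
continues in the class past `T`: `‖ω(t)‖_∞ ≤ e^{Λ(t) − Λ(t₁)} ‖ω(t₁)‖_∞` stays bounded
(`weightedVorticity_le_of_alignedStretching_le_deriv`), so `∫₀ᵀ‖ω‖_∞ < ∞` and `beale_kato_majda_holds`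
applies. For Euler this is the trajectory transport of `|ω|` by `α = ξ·Sξ` (Constantin 1994; the
proof of Chae 2010 Thm 1.1), here by the maximum principle, uniformly in `ν ≥ 0`.
[cite: Chae2010, Thm 1.1 (= arXiv:0711.1113 Thm 1.1; the transport estimate of its proof)] -/
theorem hasSobolevExtensionPast_of_alignedStretching_le_deriv {ν T t₀ : ℝ} (hν : 0 ≤ ν)
    (hT : 0 < T) (ht₀T : t₀ < T)
    {u : ℝ → EuclideanSpace ℝ (Fin 3) → EuclideanSpace ℝ (Fin 3)}
    {p : ℝ → EuclideanSpace ℝ (Fin 3) → ℝ}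
    (hsol : IsClassicalNSSolutionOn (Ico 0 T) ν 0 u p)
    (hreg : ∀ T'' < T, HasBoundedSobolevNormsOn (Icc 0 T'') u)
    {Λ lam : ℝ → ℝ} (hΛ : ∀ t ∈ Ioo 0 T, HasDerivAt Λ (lam t) t) {L : ℝ}
    (hL : ∀ t ∈ Ioo 0 T, Λ t ≤ L)
    (hstretch : ∀ t ∈ Ioo t₀ T, ∀ x,
      ⟪fderiv ℝ (u t) x (curl (u t) x), curl (u t) x⟫ ≤ lam t * ‖curl (u t) x‖ ^ 2) :
    HasSobolevExtensionPast ν u T := by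
  set t₁ : ℝ := max t₀ (T / 2) with ht₁
  have ht₁0 : 0 < t₁ := lt_of_lt_of_le (by linarith) (le_max_right _ _)
  have ht₁T : t₁ < T := max_lt ht₀T (by linarith)
  have hstretch' : ∀ t ∈ Ioo t₁ T, ∀ x,
      ⟪fderiv ℝ (u t) x (curl (u t) x), curl (u t) x⟫ ≤ lam t * ‖curl (u t) x‖ ^ 2 :=
    fun t ht => hstretch t ⟨lt_of_le_of_lt (le_max_left _ _) ht.1, ht.2⟩
  obtain ⟨M, hM⟩ :=
    weightedVorticity_le_of_alignedStretching_le_deriv hν ht₁0 ht₁T hsol hreg hΛ hstretch'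
  -- the bound on `[0, t₁]`
  have hsmooth : ∀ t ∈ Ico 0 T, ContDiff ℝ ∞ (u t) := fun t ht => hsol.contDiff_velocity ht
  obtain ⟨B₁, hB₁0, hB₁⟩ := exists_forall_norm_iteratedFDeriv_le_bkmClass
    (fun t ht => hsmooth t ⟨ht.1, ht.2.trans_lt ht₁T⟩) (hreg t₁ ht₁T) 1
  set κ₀ : ℝ := ‖(curlCLM : (EuclideanSpace ℝ (Fin 3) →L[ℝ] EuclideanSpace ℝ (Fin 3)) →L[ℝ]
    EuclideanSpace ℝ (Fin 3))‖ with hκ₀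
  have hκ₀0 : 0 ≤ κ₀ := by rw [hκ₀]; positivity
  have hcurl_le : ∀ (f : EuclideanSpace ℝ (Fin 3) → EuclideanSpace ℝ (Fin 3)) (x),
      ‖curl f x‖ ≤ κ₀ * ‖iteratedFDeriv ℝ 1 f x‖ := fun f x => by
    rw [curl_eq_curlCLM, ← norm_iteratedFDeriv_fderiv, norm_iteratedFDeriv_zero]
    exact ContinuousLinearMap.le_opNorm _ _
  -- `‖ω(t,x)‖ ≤ Kc` on `(0, T)`
  set Kc : ℝ := max (κ₀ * B₁) (Real.sqrt (Real.exp (2 * L) * M)) with hKc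
  have hbound : ∀ t ∈ Ioo 0 T, ∀ x, ‖curl (u t) x‖ ≤ Kc := by
    intro t ht x
    rcases lt_or_ge t t₁ with hlt | hge
    · exact ((hcurl_le _ x).trans (mul_le_mul_of_nonneg_left (hB₁ t ⟨ht.1.le, hlt.le⟩ x) hκ₀0)).trans
        (le_max_left _ _)
    · have h1 := hM t ⟨hge, ht.2⟩ x
      -- `‖ω‖² ≤ e^{2Λ(t)} M ≤ e^{2L} M`
      have hexp : ‖curl (u t) x‖ ^ 2 ≤ Real.exp (2 * L) * M := by
        have e : ‖curl (u t) x‖ ^ 2 = Real.exp (2 * Λ t) * (Real.exp (-2 * Λ t) * ‖curl (u t) x‖ ^ 2) := by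
          rw [← mul_assoc, ← Real.exp_add, show 2 * Λ t + -2 * Λ t = 0 by ring, Real.exp_zero, one_mul]
        rw [e]
        exact mul_le_mul (Real.exp_le_exp.2 (by linarith [hL t ht])) h1
          (mul_nonneg (Real.exp_pos _).le (sq_nonneg _)) (Real.exp_pos _).le
      have h2 : ‖curl (u t) x‖ ≤ Real.sqrt (Real.exp (2 * L) * M) := by
        rw [← Real.sqrt_sq (norm_nonneg (curl (u t) x))]
        exact Real.sqrt_le_sqrt hexp
      exact h2.trans (le_max_right _ _)
  have hfin : (∫⁻ t in Ioo 0 T, ⨆ x, ‖curl (u t) x‖ₑ) < ⊤ := by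
    have hconst : (∫⁻ _ in Ioo 0 T, ENNReal.ofReal Kc) < ⊤ := by
      rw [setLIntegral_const]
      exact ENNReal.mul_lt_top ENNReal.ofReal_lt_top (by simp [Real.volume_Ioo])
    refine lt_of_le_of_lt (setLIntegral_mono' measurableSet_Ioo fun t ht => ?_) hconst
    refine iSup_le fun x => ?_
    rw [← ofReal_norm]
    exact ENNReal.ofReal_le_ofReal (hbound t ht x)
  exact (beale_kato_majda_holds hν hT hsol hreg).2 hfin

/-- **A rate continuous on the CLOSED interval `[t₀, T]` suffices** (the simplest form of
"integrable up to `T`"): if `⟪∇u(t,x) ω, ω⟫ ≤ λ̄(t)|ω|²` on `(t₀, T) × ℝ³` with `λ̄` continuous on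
`[t₀, T]`, `0 < t₀ < T`, then the BKM-class solution (`ν ≥ 0`) continues past `T` (apply the previous
theorem with `Λ(t) = ∫_{t₀}^t λ̄`, extended constantly; `Λ ≤ (T − t₀)·max|λ̄|`). [folklore] -/
theorem hasSobolevExtensionPast_of_alignedStretching_le_continuousOn {ν T t₀ : ℝ} (hν : 0 ≤ ν)
    (hT : 0 < T) (ht₀ : 0 < t₀) (ht₀T : t₀ < T)
    {u : ℝ → EuclideanSpace ℝ (Fin 3) → EuclideanSpace ℝ (Fin 3)}
    {p : ℝ → EuclideanSpace ℝ (Fin 3) → ℝ}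
    (hsol : IsClassicalNSSolutionOn (Ico 0 T) ν 0 u p)
    (hreg : ∀ T'' < T, HasBoundedSobolevNormsOn (Icc 0 T'') u)
    {lam : ℝ → ℝ} (hlam : ContinuousOn lam (Icc t₀ T))
    (hstretch : ∀ t ∈ Ioo t₀ T, ∀ x,
      ⟪fderiv ℝ (u t) x (curl (u t) x), curl (u t) x⟫ ≤ lam t * ‖curl (u t) x‖ ^ 2) :
    HasSobolevExtensionPast ν u T := by
  -- a continuous extension of `lam` to `ℝ` (constant outside `[t₀, T]`) and its primitive
  set lamE : ℝ → ℝ := fun t => lam (max t₀ (min t T)) with hlamE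
  have hproj : Continuous fun t : ℝ => max t₀ (min t T) :=
    continuous_const.max (continuous_id.min continuous_const)
  have hproj_mem : ∀ t : ℝ, max t₀ (min t T) ∈ Icc t₀ T := fun t =>
    ⟨le_max_left _ _, max_le ht₀T.le (min_le_right _ _)⟩
  have hlamEc : Continuous lamE :=
    hlam.comp_continuous hproj hproj_mem
  have hlamE_eq : ∀ t ∈ Ioo t₀ T, lamE t = lam t := fun t ht => by
    simp only [hlamE, min_eq_left ht.2.le, max_eq_right ht.1.le]
  set Λ : ℝ → ℝ := fun t => ∫ s in t₀..t, lamE s with hΛdef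
  have hΛ : ∀ t ∈ Ioo 0 T, HasDerivAt Λ (lamE t) t := fun t _ =>
    intervalIntegral.integral_hasDerivAt_right (hlamEc.intervalIntegrable _ _)
      hlamEc.aestronglyMeasurable.stronglyMeasurableAtFilter hlamEc.continuousAt
  -- `Λ` is bounded above on `(0, T)`: `|Λ t| ≤ |t − t₀| · sup|lamE|` on the compact range
  obtain ⟨C, hC⟩ := (isCompact_Icc (a := t₀) (b := T)).exists_bound_of_continuousOn hlam
  have hL : ∀ t ∈ Ioo 0 T, Λ t ≤ (T - t₀) * C + (t₀ + T) * C := by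
    intro t ht
    have hC0 : 0 ≤ C := le_trans (norm_nonneg _) (hC t₀ ⟨le_rfl, ht₀T.le⟩)
    have hbnd : ∀ s ∈ Set.uIoc t₀ t, ‖lamE s‖ ≤ C := by
      intro s hs
      -- `lamE s = lam (proj s)` with `proj s ∈ [t₀, T]`, and `‖lam (proj s)‖ ≤ C`
      exact hC (max t₀ (min s T)) (hproj_mem s)
    have h1 : ‖Λ t‖ ≤ C * |t - t₀| := intervalIntegral.norm_integral_le_of_norm_le_const hbnd
    rw [Real.norm_eq_abs] at h1
    have h2 : |t - t₀| ≤ t₀ + T := by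
      rw [abs_le]; constructor <;> linarith [ht.1, ht.2]
    calc Λ t ≤ |Λ t| := le_abs_self _
      _ ≤ C * |t - t₀| := h1
      _ ≤ C * (t₀ + T) := mul_le_mul_of_nonneg_left h2 hC0
      _ ≤ (T - t₀) * C + (t₀ + T) * C := by nlinarith [sub_pos.2 ht₀T]
  refine hasSobolevExtensionPast_of_alignedStretching_le_deriv hν hT ht₀T hsol hreg hΛ hL ?_
  intro t ht x
  rw [hlamE_eq t ht]
  exact hstretch t ht x

/-- **Fefferman / Leray–Hopf class, contrapositive: at a singular time the aligned stretching rate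
is not dominated by any rate continuous on `[t₀, T]`.** A classical solution of unforced
Navier–Stokes (`ν, T > 0`) on `ℝ³ × [0,T)`, Leray–Hopf from its rapidly decaying datum, with no smooth
extension past `T`: for every `0 < t₀ < T` and every `λ̄` continuous on `[t₀, T]` there are
`t ∈ (t₀, T)` and `x` with `λ̄(t)|ω(t,x)|² < ⟪∇u(t,x) ω, ω⟫`. [this file] -/
theorem typeICertificateLadder_not_dominated_alignedStretching {ν T t₀ : ℝ} (hν : 0 < ν)
    (hT : 0 < T) (ht₀ : 0 < t₀) (ht₀T : t₀ < T)
    {u : ℝ → EuclideanSpace ℝ (Fin 3) → EuclideanSpace ℝ (Fin 3)}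
    {p : ℝ → EuclideanSpace ℝ (Fin 3) → ℝ}
    (hsol : IsClassicalNSSolutionOn (Ico 0 T) ν 0 u p) (hLH : IsLerayHopfOn T ν 0 (u 0) u)
    (hdec : HasRapidSpatialDecay (u 0)) (hsing : ¬ HasSmoothExtensionPast ν 0 u T)
    {lam : ℝ → ℝ} (hlam : ContinuousOn lam (Icc t₀ T)) :
    ∃ t ∈ Ioo t₀ T, ∃ x,
      lam t * ‖curl (u t) x‖ ^ 2 < ⟪fderiv ℝ (u t) x (curl (u t) x), curl (u t) x⟫ := by
  have hreg : ∀ T'' < T, HasBoundedSobolevNormsOn (Icc 0 T'') u := by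
    intro T'' hT''
    set T' : ℝ := max T'' (T / 2) with hT'
    have hT'm : T' ∈ Ioo 0 T :=
      ⟨lt_of_lt_of_le (by linarith) (le_max_right _ _), max_lt hT'' (by linarith)⟩
    obtain ⟨q, -, hB, -, -⟩ := RungReynoldsOne.stub_taoCover hν hT hsol hLH hdec hT'm
    exact hB.mono (Icc_subset_Icc_right (le_max_left _ _))
  by_contra h
  push Not at h
  exact hsing (hasSobolevExtensionPast_of_alignedStretching_le_continuousOn hν.le hT ht₀ ht₀T hsol
    hreg hlam h).hasSmoothExtensionPast

end Summit.NavierStokesRegularity.NavierStokesRegularity.Theorems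

end
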